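import Summits.AnomalousDissipation.AnomalousDissipation.Theses.MomentParity
import Summits.AnomalousDissipation.AnomalousDissipation.Theorems.MomentParityResolvedDissipationReduction
import Summits.AnomalousDissipation.AnomalousDissipation.Theorems.MomentParityResolvedDissipationStubLevelCoeff
import Summits.AnomalousDissipation.AnomalousDissipation.Theorems.MomentParityResolvedDissipationStubZeroMeanGalerkinFlow
import Summits.AnomalousDissipation.AnomalousDissipation.Theorems.MomentParityResolvedDissipationStubInvarianceAveraging
import Summits.AnomalousDissipation.AnomalousDissipation.Theorems.MomentParityResolvedDissipationStubPathwiseDissipation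
import Literature.Analysis.FluidPDE.GalerkinFlow

/-!
# `MomentParity.ResolvedDissipation` (stmt-AnomalousDissipation-14284), line `enstrophy-ui-transfer`, skeleton v3:
# TRAJECTORY-UI ⟹ RESOLVED DISSIPATION — the crux reduced to a finite-dimensional, finite-time statement

Supports stmt-AnomalousDissipation-14284 (lead c4; nothing here closes the item: the remaining hypothesis TUI is
conjecture-grade).

Write `S^N_t = Torus.galerkinFlow ν f N t` for the order-`N` Galerkin semiflow of NS(ν, P_N f) on `T³` and
`Z(v) = ‖∇v‖²` (`Torus.eGradNormSq`). **Trajectory-UI at `(f, ν, R)`** (TUI) is the statement: for some window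
`T > 0`, for every data level `G < ∞` and `ε > 0` there is ONE threshold `M < ∞` such that for EVERY order `N` and
every zero-mean Galerkin mode `a` of order `N` with `‖a‖₂² ≤ R²`, `Z(a) ≤ G`:
`∫₀ᵀ Z(S^N_t a)·1{Z(S^N_t a) > M} dt ≤ ε`.

Main results:
* `uniformIntegrability_of_trajectoryUI` — TUI at `(f, ν, R)` ⟹ the `N`-uniform uniform integrability of the
  enstrophy over all admissible laws at `(f, ν, R)` (= hypothesis of the landed Reduction, verbatim). PROOF
  (invariance averaging + Chebyshev): for an admissible law `μ` (probability, level-`N` carried, `‖u‖ ≤ R`,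
  polynomially stationary at all degrees) and `F = 1{Z>M}Z` read in Fourier coefficients,
  `∫ F dμ = T⁻¹ ∫∫₀ᵀ F(φ_t û) dt dμ` (`stub_invarianceAveraging`, from the invariance of admissible laws under the
  Galerkin semiflow); a.e. `u` is the Galerkin mode `P_N u` with the same norm, mean and enstrophy
  (`stub_levelCoeff`) and `φ_t û` are the coefficients of `S^N_t P_N u` (`galerkinFlow_realTrigPoly`); on
  `{Z ≤ G}` the time integral is `≤ εT/2` by TUI, on `{Z > G}` it is at most the full time-integrated enstrophy
  `≤ (R² + T‖f‖₂²/(4π²ν))/ν` (`stub_pathwiseDissipation`, energy identity + Poincaré along the zero-mean orbit,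
  `stub_zeroMean_galerkinFlow`) times `1 ≤ Z/G`, whose mean is `≤ ‖f‖₂|R|/(νG)` (`ensembleEnstrophy_le_budget`);
  choose `G` (`exists_threshold`).
* `resolvedAt_of_trajectoryUI` — TUI at `(f, ν, R)` ⟹ the crux's conclusion at `(f, ν, R)` (one schedule `κ` for all
  levels and all admissible laws), via `resolvedDissipation_of_uniformIntegrability` (p90097).
* `resolvedDissipation_of_trajectoryUI` — (∀ f ν R, TUI) ⟹ `ResolvedDissipation` BY NAME.
* `trajectoryUI_of_enstrophyCeiling`, `resolvedDissipation_of_enstrophyCeiling` — an `N`-uniform enstrophy CEILING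
  along Galerkin trajectories from `V`-bounded data on a window (GEB, the Galerkin form of Tao's quantitative
  regularity statement, arXiv:0710.1604 Thm 1.4; STRATEGY-CENSUS S⁺1) implies TUI trivially, hence the crux.

Status of TUI: conjecture-grade — a finite-dimensional, finite-time, measure-free form of the energy-equality
problem at fixed `ν`, namely its "no concentration in time" half: by Vitali, modulo the classical Galerkin →
Leray–Hopf compactness for `L²`-convergent data, it is IMPLIED by the energy EQUALITY on `[0, T]` of Galerkin-limit
Leray–Hopf solutions from `V`-bounded data (strong `L²H¹` convergence ⟹ `L¹(0,T)`-convergence of the enstrophies ⟹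
uniform integrability), hence by the Leray–Hopf energy equality between positive times plus local strong theory, and
by NS regularity; its failure produces a Galerkin-limit Leray–Hopf solution from `V`-data with an energy defect
concentrated in time at unbounded enstrophy levels. (The complementary "no escape in wavenumber at bounded enstrophy"
is, for stationary laws, a theorem — the FGT weighted `H²` bound inside the Reduction — which is why TUI suffices.)
So the crux now sits in `[¬(persistent blow-up), TUI]`, and TUI is implied by LHEE (modulo classical facts).
-/

noncomputable section

-- `Summit.<Summit>.<Problem>`: single-conjunct summit, the duplicate namespace segment is mandated.
set_option linter.dupNamespace false

namespace Summit.AnomalousDissipation.AnomalousDissipation.Theorems.MomentParityResolvedDissipation.TrajectoryUI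

open MeasureTheory Filter Topology Set
open scoped ENNReal InnerProductSpace RealInnerProductSpace
open Literature.Analysis.FunctionSpaces Literature.Analysis.FluidPDE
open Summit.AnomalousDissipation.AnomalousDissipation.Theses.MomentParity
open Summit.AnomalousDissipation.AnomalousDissipation.Theorems.CubicParityLoud.Negative (T3 R3 H3 L2T3)
open Summit.AnomalousDissipation.AnomalousDissipation.Theorems.QuarticGate.Negative
  (IsLevel IsBandTest polyGrad IsPolyStationary)

/-- **Parameter choice** for the Chebyshev split: given the window `T > 0`, the pathwise constant `b ≥ 0`, the
budget `bud ≥ 0` and a tolerance `ε' > 0`, the enstrophy threshold `g = 2 b bud/(T ε') + 1 > 0` makes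
`T⁻¹ (T ε'/2 + b · bud/g) ≤ ε'`. [folklore] -/
theorem exists_threshold {T b bud ε' : ℝ} (hT : 0 < T) (hb : 0 ≤ b) (hbud : 0 ≤ bud) (hε : 0 < ε') :
    ∃ g : ℝ, 0 < g ∧ T⁻¹ * (T * ε' / 2 + b * (bud * g⁻¹)) ≤ ε' := by
  refine ⟨2 * b * bud / (T * ε') + 1, by positivity, ?_⟩
  have hg0 : 0 < 2 * b * bud / (T * ε') + 1 := by positivity
  have hkey : b * (bud * (2 * b * bud / (T * ε') + 1)⁻¹) ≤ T * ε' / 2 := by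
    rw [← div_eq_mul_inv, mul_div_assoc', div_le_iff₀ hg0]
    have : T * ε' / 2 * (2 * b * bud / (T * ε') + 1) = b * bud + T * ε' / 2 := by
      field_simp
    rw [this]
    linarith [mul_pos hT hε]
  calc T⁻¹ * (T * ε' / 2 + b * (bud * (2 * b * bud / (T * ε') + 1)⁻¹))
      ≤ T⁻¹ * (T * ε' / 2 + T * ε' / 2) := by gcongr
    _ = ε' := by field_simp; norm_num

/-- Continuity of the band enstrophy `c ↦ 4π² Σ_{k∈S} |k|² ‖c̄ k‖²` on coefficient vectors. [folklore] -/
theorem continuous_bandEnstrophy (S : Finset (Fin 3 → ℤ)) :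
    Continuous fun c : ↥S → EuclideanSpace ℂ (Fin 3) =>
      4 * Real.pi ^ 2 * ∑ k ∈ S, Torus.freqNormSq k * ‖Torus.coeffExt S c k‖ ^ 2 := by
  refine continuous_const.mul (continuous_finsetSum _ fun k _ => continuous_const.mul ?_)
  exact ((contDiff_coeffExt_apply (S := S) k (n := 0)).continuous.norm).pow 2

/-- **Glue with the stubs as hypotheses**: S2a (zero mean along the flow), S2 (pathwise dissipation bound),
S3 (invariance averaging), S4 (coefficient dictionary) and trajectory-UI at `(f, ν, R)` imply the `N`-uniform
uniform integrability of the enstrophy over the admissible laws at `(f, ν, R)` (the hypothesis of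
`resolvedDissipation_of_uniformIntegrability`, verbatim). -/
theorem uniformIntegrability_of_trajectoryUI_of_stubs
    (hS2a : ∀ (ν : ℝ), 0 ≤ ν → ∀ (f : T3 → R3), Torus.IsSmooth f → Torus.HasZeroMean f →
      ∀ (N : ℕ) (a : T3 → R3), IsGalerkinMode N a → Torus.HasZeroMean a →
      ∀ t : ℝ, 0 ≤ t → Torus.HasZeroMean (Torus.galerkinFlow ν f N t a))
    (hS2 : ∀ (ν : ℝ), 0 < ν → ∀ (f : T3 → R3), Torus.IsSmooth f →
      ∀ (N : ℕ) (a : T3 → R3), IsGalerkinMode N a →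
        (∀ t : ℝ, 0 ≤ t → Torus.HasZeroMean (Torus.galerkinFlow ν f N t a)) →
      ∀ T : ℝ, 0 ≤ T →
        ∫⁻ t in Set.Ioo 0 T, Torus.eGradNormSq (Torus.galerkinFlow ν f N t a) ≤
          ENNReal.ofReal ((∫ x, ‖a x‖ ^ 2 + T * (∫ x, ‖f x‖ ^ 2) / (4 * Real.pi ^ 2 * ν)) / ν))
    (hS3 : ∀ (ν : ℝ), 0 < ν → ∀ (f : T3 → R3), Torus.IsSmooth f → Torus.HasZeroMean f →
      ∀ (N : ℕ) (R : ℝ) (μ : Measure H3), IsProbabilityMeasure μ →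
        (∀ᵐ u ∂μ, IsLevel N u) → (∀ᵐ u ∂μ, ‖u‖ ≤ R) → (∀ d : ℕ, IsPolyStationary ν f N d μ) →
      ∀ T : ℝ, 0 < T →
      ∀ F : (↥(Torus.freqBall (d := Fin 3) N) → EuclideanSpace ℂ (Fin 3)) → ℝ≥0∞, Measurable F →
        ∫⁻ u, F (fourierRestrict (Torus.freqBall N) (u.1 : T3 → R3)) ∂μ =
          (ENNReal.ofReal T)⁻¹ *
            ∫⁻ u, (∫⁻ t in Set.Ioo 0 T,
              F (galerkinCoeffFlow ν (fourierRestrict (Torus.freqBall N) f) t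
                (fourierRestrict (Torus.freqBall N) (u.1 : T3 → R3)))) ∂μ)
    (hS4 : ∀ (N : ℕ) (u : H3), IsLevel N u →
      IsGalerkinMode N (Torus.realTrigPoly (Torus.freqBall N)
        (Torus.coeffExt (Torus.freqBall N) (fourierRestrict (Torus.freqBall N) (u.1 : T3 → R3)))) ∧
      Torus.HasZeroMean (Torus.realTrigPoly (Torus.freqBall N)
        (Torus.coeffExt (Torus.freqBall N) (fourierRestrict (Torus.freqBall N) (u.1 : T3 → R3)))) ∧
      ∫ x, ‖Torus.realTrigPoly (Torus.freqBall N)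
        (Torus.coeffExt (Torus.freqBall N) (fourierRestrict (Torus.freqBall N) (u.1 : T3 → R3))) x‖ ^ 2 =
          ‖u‖ ^ 2 ∧
      Torus.eGradNormSq (Torus.realTrigPoly (Torus.freqBall N)
        (Torus.coeffExt (Torus.freqBall N) (fourierRestrict (Torus.freqBall N) (u.1 : T3 → R3)))) =
          Torus.eGradNormSq (u.1 : T3 → R3))
    (f : T3 → R3) (hf : Torus.IsSmooth f) (h0 : Torus.HasZeroMean f)
    (ν : ℝ) (hν : 0 < ν) (R : ℝ)
    (hTUI : ∃ T : ℝ, 0 < T ∧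
        ∀ G : ℝ≥0∞, G ≠ ⊤ → ∀ ε : ℝ≥0∞, 0 < ε → ∃ M : ℝ≥0∞, M ≠ ⊤ ∧
          ∀ (N : ℕ) (a : UnitAddTorus (Fin 3) → EuclideanSpace ℝ (Fin 3)),
            IsGalerkinMode N a → Torus.HasZeroMean a → ∫ x, ‖a x‖ ^ 2 ≤ R ^ 2 →
            Torus.eGradNormSq a ≤ G →
            ∫⁻ t in Set.Ioo 0 T, (Set.Ioi M).indicator id
                (Torus.eGradNormSq (Torus.galerkinFlow ν f N t a)) ≤ ε) :
    ∀ ε : ℝ≥0∞, 0 < ε → ∃ M : ℝ≥0∞, M ≠ ⊤ ∧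
        ∀ (N : ℕ) (μ : Measure (Torus.energySpace (Fin 3))), IsProbabilityMeasure μ →
          (∀ᵐ u ∂μ, IsLevel N u) → (∀ᵐ u ∂μ, ‖u‖ ≤ R) → (∀ d : ℕ, IsPolyStationary ν f N d μ) →
          ∫⁻ u in {u : Torus.energySpace (Fin 3) |
              M < Torus.eGradNormSq (u.1 : UnitAddTorus (Fin 3) → EuclideanSpace ℝ (Fin 3))},
            Torus.eGradNormSq (u.1 : UnitAddTorus (Fin 3) → EuclideanSpace ℝ (Fin 3)) ∂μ ≤ ε := by
  intro ε hε
  obtain ⟨T, hT, hTUI⟩ := hTUI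
  -- a real tolerance `ε'` below `ε`
  set ε' : ℝ := if ε = ⊤ then 1 else ε.toReal with hε'
  have hε'pos : 0 < ε' := by
    rw [hε']
    split_ifs with h
    · exact one_pos
    · exact ENNReal.toReal_pos hε.ne' h
  have hε'le : ENNReal.ofReal ε' ≤ ε := by
    rw [hε']
    split_ifs with h
    · rw [h]; exact le_top
    · exact ENNReal.ofReal_toReal_le
  -- the two constants of the split
  have hf2 : 0 ≤ ∫ x, ‖f x‖ ^ 2 := integral_nonneg fun _ => by positivity
  set b : ℝ := (R ^ 2 + T * (∫ x, ‖f x‖ ^ 2) / (4 * Real.pi ^ 2 * ν)) / ν with hb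
  have hb0 : 0 ≤ b := by positivity
  set bud : ℝ := Real.sqrt (∫ x, ‖f x‖ ^ 2) * |R| / ν with hbud
  have hbud0 : 0 ≤ bud := by positivity
  obtain ⟨g, hg, hgoal⟩ := exists_threshold hT hb0 hbud0 hε'pos
  have hTε : 0 < T * ε' / 2 := by positivity
  obtain ⟨M, hM, hMui⟩ := hTUI (ENNReal.ofReal g) ENNReal.ofReal_ne_top (ENNReal.ofReal (T * ε' / 2))
    (ENNReal.ofReal_pos.2 hTε)
  refine ⟨M, hM, fun N μ hP hL hB hS => ?_⟩
  -- notation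
  set S : Finset (Fin 3 → ℤ) := Torus.freqBall (d := Fin 3) N with hSdef
  have hSsym : ∀ k ∈ S, -k ∈ S := fun k hk => Torus.neg_mem_freqBall_of_mem k hk
  set Θ : H3 → (↥S → EuclideanSpace ℂ (Fin 3)) := fun u => fourierRestrict S (u.1 : T3 → R3) with hΘ
  have hΘmem : ∀ u : H3, Θ u ∈ galerkinSubspace S := fun u =>
    MomentParity.fourierRestrict_coe_mem_galerkinSubspace N u
  set zr : (↥S → EuclideanSpace ℂ (Fin 3)) → ℝ := fun c =>
    4 * Real.pi ^ 2 * ∑ k ∈ S, Torus.freqNormSq k * ‖Torus.coeffExt S c k‖ ^ 2 with hzr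
  set F : (↥S → EuclideanSpace ℂ (Fin 3)) → ℝ≥0∞ := fun c =>
    (Set.Ioi M).indicator id (ENNReal.ofReal (zr c)) with hF
  have hFm : Measurable F :=
    (measurable_id.indicator measurableSet_Ioi).comp
      (ENNReal.measurable_ofReal.comp (continuous_bandEnstrophy S).measurable)
  -- the band enstrophy is the spectral enstrophy on the phase space
  have hZr : ∀ c ∈ galerkinSubspace S,
      Torus.eGradNormSq (Torus.realTrigPoly S (Torus.coeffExt S c)) = ENNReal.ofReal (zr c) :=
    fun c hc => Torus.eGradNormSq_realTrigPoly hSsym (hc.1.isConjSymm_coeffExt hSsym)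
  -- measurability of the enstrophy on `H`
  have hZm : Measurable fun u : H3 => Torus.eGradNormSq (u.1 : T3 → R3) := Torus.measurable_eGradNormSq_coe
  -- Step 1: the tail integral as the integral of the truncated enstrophy
  have h1 : ∫⁻ u in {u : H3 | M < Torus.eGradNormSq (u.1 : T3 → R3)}, Torus.eGradNormSq (u.1 : T3 → R3) ∂μ =
      ∫⁻ u, (Set.Ioi M).indicator id (Torus.eGradNormSq (u.1 : T3 → R3)) ∂μ := by
    rw [← lintegral_indicator (measurableSet_lt measurable_const hZm)]
    refine lintegral_congr fun u => ?_
    simp only [Set.indicator, Set.mem_setOf_eq, Set.mem_Ioi, id]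
  -- Step 2: a.e. the truncated enstrophy is `F ∘ Θ`
  have h2 : ∀ᵐ u ∂μ, (Set.Ioi M).indicator id (Torus.eGradNormSq (u.1 : T3 → R3)) = F (Θ u) := by
    filter_upwards [hL] with u hu
    have h4 := (hS4 N u hu).2.2.2
    simp only [hF]
    rw [← hZr _ (hΘmem u), ← h4]
  -- Step 4 (pointwise): the inner time integral along the orbit of a.e. `u`
  have h4 : ∀ᵐ u ∂μ, (∫⁻ t in Set.Ioo 0 T, F (galerkinCoeffFlow ν (fourierRestrict S f) t (Θ u))) ≤
      ENNReal.ofReal (T * ε' / 2) +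
        ENNReal.ofReal b * (Torus.eGradNormSq (u.1 : T3 → R3) / ENNReal.ofReal g) := by
    filter_upwards [hL, hB] with u hu hub
    obtain ⟨hmode, hmean, hnorm, hgrad⟩ := hS4 N u hu
    set a : T3 → R3 := Torus.realTrigPoly S (Torus.coeffExt S (Θ u)) with ha
    -- conjugacy: the orbit of `a` read through `F`
    have hflow : ∀ t, F (galerkinCoeffFlow ν (fourierRestrict S f) t (Θ u)) =
        (Set.Ioi M).indicator id (Torus.eGradNormSq (Torus.galerkinFlow ν f N t a)) := by
      intro t
      simp only [hF]
      rw [ha, Torus.galerkinFlow_realTrigPoly (hΘmem u) t, hZr _ (galerkinCoeffFlow_mem (hΘmem u) t)]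
    simp_rw [hflow]
    have hR2 : ∫ x, ‖a x‖ ^ 2 ≤ R ^ 2 := by
      rw [hnorm]
      exact pow_le_pow_left₀ (norm_nonneg _) hub 2
    by_cases hsmall : Torus.eGradNormSq (u.1 : T3 → R3) ≤ ENNReal.ofReal g
    · have := hMui N a hmode hmean hR2 (hgrad.symm ▸ hsmall)
      exact this.trans le_self_add
    · replace hsmall := not_le.1 hsmall
      have hmeanflow := hS2a ν hν.le f hf h0 N a hmode hmean
      have hpath := hS2 ν hν f hf N a hmode hmeanflow T hT.le
      have hle_b : ENNReal.ofReal ((∫ x, ‖a x‖ ^ 2 + T * (∫ x, ‖f x‖ ^ 2) / (4 * Real.pi ^ 2 * ν)) / ν) ≤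
          ENNReal.ofReal b := by
        refine ENNReal.ofReal_le_ofReal ?_
        -- NB: the registered bound reads `∫ x, (‖a x‖² + const)`; on the probability space `T³` this is
        -- `∫‖a‖² + const`.
        have hai : Integrable (fun x => ‖a x‖ ^ 2) volume :=
          (hmode.isSmooth.continuous.norm.pow 2).integrable_unitAddTorus
        have hnum : ∫ x, ‖a x‖ ^ 2 + T * (∫ x, ‖f x‖ ^ 2) / (4 * Real.pi ^ 2 * ν) ≤
            R ^ 2 + T * (∫ x, ‖f x‖ ^ 2) / (4 * Real.pi ^ 2 * ν) := by
          rw [integral_add hai (integrable_const _), integral_const, probReal_univ, one_smul]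
          exact add_le_add hR2 le_rfl
        exact div_le_div_of_nonneg_right hnum hν.le
      have hone : 1 ≤ Torus.eGradNormSq (u.1 : T3 → R3) / ENNReal.ofReal g := by
        rw [ENNReal.le_div_iff_mul_le (Or.inl (ENNReal.ofReal_pos.2 hg).ne') (Or.inl ENNReal.ofReal_ne_top),
          one_mul]
        exact hsmall.le
      calc (∫⁻ t in Set.Ioo 0 T, (Set.Ioi M).indicator id (Torus.eGradNormSq (Torus.galerkinFlow ν f N t a)))
          ≤ ∫⁻ t in Set.Ioo 0 T, Torus.eGradNormSq (Torus.galerkinFlow ν f N t a) :=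
            lintegral_mono fun t => Set.indicator_le_self _ _ _
        _ ≤ ENNReal.ofReal b := hpath.trans hle_b
        _ ≤ ENNReal.ofReal b * (Torus.eGradNormSq (u.1 : T3 → R3) / ENNReal.ofReal g) := by
            simpa only [mul_one] using mul_le_mul_right hone (ENNReal.ofReal b)
        _ ≤ _ := le_add_self
  -- the budget
  have hbudget : ∫⁻ u, Torus.eGradNormSq (u.1 : T3 → R3) ∂μ ≤ ENNReal.ofReal bud := by
    have := ensembleEnstrophy_le_budget hν (hf.memLp 2) hP hL hB hS
    refine this.trans (ENNReal.ofReal_le_ofReal ?_)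
    rw [hbud]
    gcongr
    exact le_abs_self R
  -- assemble
  calc ∫⁻ u in {u : H3 | M < Torus.eGradNormSq (u.1 : T3 → R3)}, Torus.eGradNormSq (u.1 : T3 → R3) ∂μ
      = ∫⁻ u, F (Θ u) ∂μ := by rw [h1]; exact lintegral_congr_ae h2
    _ = (ENNReal.ofReal T)⁻¹ *
          ∫⁻ u, (∫⁻ t in Set.Ioo 0 T, F (galerkinCoeffFlow ν (fourierRestrict S f) t (Θ u))) ∂μ :=
        hS3 ν hν f hf h0 N R μ hP hL hB hS T hT F hFm
    _ ≤ (ENNReal.ofReal T)⁻¹ * ∫⁻ u, (ENNReal.ofReal (T * ε' / 2) +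
          ENNReal.ofReal b * (Torus.eGradNormSq (u.1 : T3 → R3) / ENNReal.ofReal g)) ∂μ := by
        exact mul_le_mul_right (lintegral_mono_ae h4) _
    _ = (ENNReal.ofReal T)⁻¹ * (ENNReal.ofReal (T * ε' / 2) +
          ENNReal.ofReal b * ((∫⁻ u, Torus.eGradNormSq (u.1 : T3 → R3) ∂μ) * (ENNReal.ofReal g)⁻¹)) := by
        rw [lintegral_add_left measurable_const, lintegral_const, measure_univ, mul_one,
          lintegral_const_mul' _ _ ENNReal.ofReal_ne_top]
        simp_rw [div_eq_mul_inv]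
        rw [lintegral_mul_const' _ _ (ENNReal.inv_ne_top.2 (ENNReal.ofReal_pos.2 hg).ne')]
    _ ≤ (ENNReal.ofReal T)⁻¹ * (ENNReal.ofReal (T * ε' / 2) +
          ENNReal.ofReal b * (ENNReal.ofReal bud * (ENNReal.ofReal g)⁻¹)) := by
        gcongr
    _ = ENNReal.ofReal (T⁻¹ * (T * ε' / 2 + b * (bud * g⁻¹))) := by
        rw [← ENNReal.ofReal_inv_of_pos hg, ← ENNReal.ofReal_inv_of_pos hT,
          ← ENNReal.ofReal_mul hbud0, ← ENNReal.ofReal_mul hb0, ← ENNReal.ofReal_add hTε.le (by positivity),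
          ← ENNReal.ofReal_mul (inv_nonneg.2 hT.le)]
    _ ≤ ENNReal.ofReal ε' := ENNReal.ofReal_le_ofReal hgoal
    _ ≤ ε := hε'le

/-- **GEB ⟹ TUI** (the strategist's S⁺1 as a special case): an `N`-uniform enstrophy CEILING along Galerkin
trajectories from `V`-bounded zero-mean data in the `L²`-ball over the window `(0, T)` — for every data level
`G < ∞` one ceiling `M < ∞` for all orders `N` — gives trajectory-UI on that window trivially (the truncated
integrand vanishes identically). GEB is the Galerkin form of the quantitative regularity statement of
Tao (arXiv:0710.1604, Thm. 1.4); it is recorded to make `GEB ⟹ RD` a corollary of the glue. [folklore] -/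
theorem trajectoryUI_of_enstrophyCeiling {f : T3 → R3} {ν R T : ℝ} (hT : 0 < T)
    (hGEB : ∀ G : ℝ≥0∞, G ≠ ⊤ → ∃ M : ℝ≥0∞, M ≠ ⊤ ∧ ∀ (N : ℕ) (a : T3 → R3),
      IsGalerkinMode N a → Torus.HasZeroMean a → ∫ x, ‖a x‖ ^ 2 ≤ R ^ 2 → Torus.eGradNormSq a ≤ G →
      ∀ t ∈ Set.Ioo 0 T, Torus.eGradNormSq (Torus.galerkinFlow ν f N t a) ≤ M) :
    ∃ T : ℝ, 0 < T ∧
        ∀ G : ℝ≥0∞, G ≠ ⊤ → ∀ ε : ℝ≥0∞, 0 < ε → ∃ M : ℝ≥0∞, M ≠ ⊤ ∧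
          ∀ (N : ℕ) (a : UnitAddTorus (Fin 3) → EuclideanSpace ℝ (Fin 3)),
            IsGalerkinMode N a → Torus.HasZeroMean a → ∫ x, ‖a x‖ ^ 2 ≤ R ^ 2 →
            Torus.eGradNormSq a ≤ G →
            ∫⁻ t in Set.Ioo 0 T, (Set.Ioi M).indicator id
                (Torus.eGradNormSq (Torus.galerkinFlow ν f N t a)) ≤ ε := by
  refine ⟨T, hT, fun G hG ε _ => ?_⟩
  obtain ⟨M, hM, hb⟩ := hGEB G hG
  refine ⟨M, hM, fun N a ha h0 hR hGa => ?_⟩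
  have hzero : ∀ t ∈ Set.Ioo 0 T,
      (Set.Ioi M).indicator id (Torus.eGradNormSq (Torus.galerkinFlow ν f N t a)) = 0 := fun t ht =>
    Set.indicator_of_notMem (fun h : Torus.eGradNormSq (Torus.galerkinFlow ν f N t a) ∈ Set.Ioi M =>
      (not_lt.2 (hb N a ha h0 hR hGa t ht)) h) _
  rw [setLIntegral_congr_fun measurableSet_Ioo hzero, lintegral_zero]
  exact bot_le

/-! ## Instantiation with the landed stubs -/

/-- **TUI ⟹ U.** Trajectory-UI at `(f, ν, R)` implies the `N`-uniform uniform integrability of the enstrophy over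
the admissible laws at `(f, ν, R)` — the glue `uniformIntegrability_of_trajectoryUI_of_stubs` fed with the landed
stubs `stub_zeroMean_galerkinFlow` (p139620), `stub_pathwiseDissipation`, `stub_invarianceAveraging` (p139785),
`stub_levelCoeff` (p139584). -/
theorem uniformIntegrability_of_trajectoryUI
    (f : T3 → R3) (hf : Torus.IsSmooth f) (h0 : Torus.HasZeroMean f) (ν : ℝ) (hν : 0 < ν) (R : ℝ)
    (hTUI : ∃ T : ℝ, 0 < T ∧
        ∀ G : ℝ≥0∞, G ≠ ⊤ → ∀ ε : ℝ≥0∞, 0 < ε → ∃ M : ℝ≥0∞, M ≠ ⊤ ∧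
          ∀ (N : ℕ) (a : UnitAddTorus (Fin 3) → EuclideanSpace ℝ (Fin 3)),
            IsGalerkinMode N a → Torus.HasZeroMean a → ∫ x, ‖a x‖ ^ 2 ≤ R ^ 2 →
            Torus.eGradNormSq a ≤ G →
            ∫⁻ t in Set.Ioo 0 T, (Set.Ioi M).indicator id
                (Torus.eGradNormSq (Torus.galerkinFlow ν f N t a)) ≤ ε) :
    ∀ ε : ℝ≥0∞, 0 < ε → ∃ M : ℝ≥0∞, M ≠ ⊤ ∧
        ∀ (N : ℕ) (μ : Measure (Torus.energySpace (Fin 3))), IsProbabilityMeasure μ →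
          (∀ᵐ u ∂μ, IsLevel N u) → (∀ᵐ u ∂μ, ‖u‖ ≤ R) → (∀ d : ℕ, IsPolyStationary ν f N d μ) →
          ∫⁻ u in {u : Torus.energySpace (Fin 3) |
              M < Torus.eGradNormSq (u.1 : UnitAddTorus (Fin 3) → EuclideanSpace ℝ (Fin 3))},
            Torus.eGradNormSq (u.1 : UnitAddTorus (Fin 3) → EuclideanSpace ℝ (Fin 3)) ∂μ ≤ ε :=
  uniformIntegrability_of_trajectoryUI_of_stubs ZeroMeanFlow.stub_zeroMean_galerkinFlow
    PathwiseDissipation.stub_pathwiseDissipation InvarianceAveraging.stub_invarianceAveraging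
    LevelCoeff.stub_levelCoeff f hf h0 ν hν R hTUI

/-- **TUI ⟹ the crux's conclusion at `(f, ν, R)`**: trajectory-UI at `(f, ν, R)` (for a smooth zero-mean force
`f`, `ν > 0`) yields ONE resolution schedule `κ` such that every admissible law at every level `N` has
`∫‖∇u‖² dμ ≤ ∫‖∇P_{κ n}u‖² dμ + 1/(n+1)` for all `n` (the body of `ResolvedDissipation`, clauses unfolded through
`IsLevel`/`IsPolyStationary`), via the landed Reduction `resolvedDissipation_of_uniformIntegrability`. -/
theorem resolvedAt_of_trajectoryUI
    (f : T3 → R3) (hf : Torus.IsSmooth f) (h0 : Torus.HasZeroMean f) (ν : ℝ) (hν : 0 < ν) (R : ℝ)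
    (hTUI : ∃ T : ℝ, 0 < T ∧
        ∀ G : ℝ≥0∞, G ≠ ⊤ → ∀ ε : ℝ≥0∞, 0 < ε → ∃ M : ℝ≥0∞, M ≠ ⊤ ∧
          ∀ (N : ℕ) (a : UnitAddTorus (Fin 3) → EuclideanSpace ℝ (Fin 3)),
            IsGalerkinMode N a → Torus.HasZeroMean a → ∫ x, ‖a x‖ ^ 2 ≤ R ^ 2 →
            Torus.eGradNormSq a ≤ G →
            ∫⁻ t in Set.Ioo 0 T, (Set.Ioi M).indicator id
                (Torus.eGradNormSq (Torus.galerkinFlow ν f N t a)) ≤ ε) :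
    ∃ κ : ℕ → ℕ, ∀ (N : ℕ) (μ : Measure (Torus.energySpace (Fin 3))), IsProbabilityMeasure μ →
      (∀ᵐ u ∂μ, IsLevel N u) → (∀ᵐ u ∂μ, ‖u‖ ≤ R) → (∀ d : ℕ, IsPolyStationary ν f N d μ) →
      ∀ n : ℕ, ∫⁻ u, Torus.eGradNormSq (u.1 : UnitAddTorus (Fin 3) → EuclideanSpace ℝ (Fin 3)) ∂μ ≤
        (∫⁻ u, Torus.eGradNormSq (Torus.fourierTruncate (κ n)
          (u.1 : UnitAddTorus (Fin 3) → EuclideanSpace ℝ (Fin 3))) ∂μ) + ((n : ℝ≥0∞) + 1)⁻¹ :=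
  resolvedDissipation_of_uniformIntegrability f hf ν hν R
    (uniformIntegrability_of_trajectoryUI f hf h0 ν hν R hTUI)

/-- **TUI (for all forces, viscosities and radii) ⟹ `ResolvedDissipation`** (the route decl BY NAME). The
divergence-free clause of the crux is not even needed. -/
theorem resolvedDissipation_of_trajectoryUI
    (hTUI : ∀ f : UnitAddTorus (Fin 3) → EuclideanSpace ℝ (Fin 3),
      Torus.IsSmooth f → Torus.IsDivFree f → Torus.HasZeroMean f →
      ∀ ν : ℝ, 0 < ν → ∀ R : ℝ, ∃ T : ℝ, 0 < T ∧
        ∀ G : ℝ≥0∞, G ≠ ⊤ → ∀ ε : ℝ≥0∞, 0 < ε → ∃ M : ℝ≥0∞, M ≠ ⊤ ∧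
          ∀ (N : ℕ) (a : UnitAddTorus (Fin 3) → EuclideanSpace ℝ (Fin 3)),
            IsGalerkinMode N a → Torus.HasZeroMean a → ∫ x, ‖a x‖ ^ 2 ≤ R ^ 2 →
            Torus.eGradNormSq a ≤ G →
            ∫⁻ t in Set.Ioo 0 T, (Set.Ioi M).indicator id
                (Torus.eGradNormSq (Torus.galerkinFlow ν f N t a)) ≤ ε) :
    ResolvedDissipation := by
  intro f hf hdiv hzero ν hν R
  obtain ⟨κ, hκ⟩ := resolvedAt_of_trajectoryUI f hf hzero ν hν R (hTUI f hf hdiv hzero ν hν R)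
  refine ⟨κ, fun N μ hp hl hb hs n => hκ N μ hp hl hb ?_ n⟩
  intro d m g P hg _
  exact hs m g P hg

/-- **GEB ⟹ `ResolvedDissipation`** (STRATEGY-CENSUS S⁺1, now a tree theorem): an `N`-uniform enstrophy ceiling
along Galerkin trajectories from `V`-bounded zero-mean data in the `L²`-ball over some window, at every
`(f, ν, R)`, implies the crux — through `trajectoryUI_of_enstrophyCeiling` and `resolvedDissipation_of_trajectoryUI`.
GEB is regularity-class (the Galerkin form of Tao's quantitative formulation of NS regularity, arXiv:0710.1604
Thm 1.4); this is an upper bracket, not a closure. -/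
theorem resolvedDissipation_of_enstrophyCeiling
    (hGEB : ∀ f : UnitAddTorus (Fin 3) → EuclideanSpace ℝ (Fin 3),
      Torus.IsSmooth f → Torus.IsDivFree f → Torus.HasZeroMean f →
      ∀ ν : ℝ, 0 < ν → ∀ R : ℝ, ∃ T : ℝ, 0 < T ∧
        ∀ G : ℝ≥0∞, G ≠ ⊤ → ∃ M : ℝ≥0∞, M ≠ ⊤ ∧ ∀ (N : ℕ) (a : T3 → R3),
          IsGalerkinMode N a → Torus.HasZeroMean a → ∫ x, ‖a x‖ ^ 2 ≤ R ^ 2 → Torus.eGradNormSq a ≤ G →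
          ∀ t ∈ Set.Ioo 0 T, Torus.eGradNormSq (Torus.galerkinFlow ν f N t a) ≤ M) :
    ResolvedDissipation := by
  refine resolvedDissipation_of_trajectoryUI fun f hf hdiv hzero ν hν R => ?_
  obtain ⟨T, hT, h⟩ := hGEB f hf hdiv hzero ν hν R
  exact trajectoryUI_of_enstrophyCeiling hT h

end Summit.AnomalousDissipation.AnomalousDissipation.Theorems.MomentParityResolvedDissipation.TrajectoryUI

end
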